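import Summits.QuantumFields.YangMills.Theorems.PoincareLipschitzLogCutoffStabilityCapFlat
import Summits.QuantumFields.YangMills.Theorems.PoincareLipschitzEuclideanTwistDictionary
import HarnessLib

/-!
# Crux `HistoryTailL` (stmt-QuantumFields-19936), K2 organ of record `hImproveCoreFlat` (LEAD ★w1-19936 g9 RULING g9-8, FROZEN v1 bac8eda3):
# ★★★ THE ORGAN OF RECORD IS PARAMETER-FREE — `hImproveCoreFlat∣_{Λ₀ := 21} ⟹ hImproveCoreFlat` v1 VERBATIM, inside the FLAT world
# (no twist dictionary beyond `E⁴ ↔ Fin 4 → ℝ`, no K-5 detour), by the log-cutoff stability cap for (∀ (z' : Zd 3) (ρ : ℤ), 0 ≤ ρ → box z' (ρ + 1) ⊆ box z R →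
        ∀ v : Zd 3 → EuclideanSpace ℝ (Fin 4), (∀ y, y ∉ box z' ρ → v y = u y) → (∀ y ∈ box z' ρ, ‖v y‖ = 1) →
        ∑ y ∈ box z' (ρ + 1), ∑ μ : Fin 3, ‖u (y + unitVec μ) - u y‖ ^ 2 ≤
        (∑ y ∈ box z' (ρ + 1), ∑ μ : Fin 3, ‖v (y + unitVec μ) - v y‖ ^ 2) + δ * ((ρ : ℝ) + 1))-minimisers (✓∕⧗`…StabilityCapFlat`)

Cell `ym3-torus` (YM ladder rung R3 = continuum SU(2) Yang–Mills on the three-torus — a RUNG, NOT the Clay problem: not d = 4, not infinite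
volume, not a mass gap), WIDTH seat `ym-ust-19936-w3` gen 14; `--supports stmt-QuantumFields-19936 --as helper`; THEOREMS ONLY, definition-free.
Imports `…LogCutoffStabilityCapFlat` (★★★`exists_scale_energy_le_flat`, over ★w2 g12's ✓p712185 slack second variation) and ✓p711276
`…EuclideanTwistDictionary` (`inner_eq_dot`, `norm_sq_eq_dot`, `dot_self_eq_one_of_norm`, `norm_eq_one_of_ofLp_eq_varied`, `eq_of_ofLp_eq_varied_of_zero`).

WHY.  ERRATUM-DRIVEN (★w3 g14 10:26Z): the flat organ's almost-minimality row with slack `δ(ρ+1)` DOES support the log-cutoff cap, because the slack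
enters as `8σ∕t²` with `σ = δR∕2 ≍ δC₁r` against main terms `≍ r log C₁` — both linear in the scale — so the `∃δ` of the organ (chosen after `ε₁`)
can be taken `≤ 1∕(6400·C₁)`.  §1: the row (at `(z, R−1)`) applied to the Leung–Xin competitor `x ↦ toLp(U_t^{a,η}(x))` gives
✓`exists_scale_energy_le_flat`'s hypothesis «varied correlation ≤ correlation + δR∕2» on `Q_R(z) × Fin 3` (`‖w′ − w‖² = 2 − 2⟪w,w′⟫` for unit
vectors, `⟪·,·⟫ = ofLp · ⬝ ofLp ·`).  §2: one good scale per window in the organ's letters.  §3 ★★★: given `(Λ₀, ε₁)`, take `(δ′, C₀′, R₀′)` from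
the capped organ at `ε₁`, `C₁ := C₁(20)`, `δ := min δ′ (6400C₁)⁻¹`, `r := ⌊(R−5)∕(2C₁)⌋`, `M := ⌈C₁r⌉` (so `2M ≤ R−1`, `R ≤ 4C₁r`, `1600δR ≤ r`);
the cap at `c = 20` yields `k ∈ [r, M)` with `E(Q_{k−1}) ≤ 20k ≤ 21(k−1)` (`k ≥ 21`); the capped organ at the top scale `k−1 ≥ R₀′` (slack
`δ ≤ δ′`, rows hereditary) returns `r′`; `R ≤ (8C₁+10)C₀′·r′`.  CONSEQUENCE: with w7's ✓`flat_of_halving` band form (F §1) and LEAD's ✓K-6, the organ of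
record reads `hImproveCoreFlat ⟸ ⟨halving on the band [Λ⋆, 21]⟩` — all flat; and with ✓K-5∕K-4b∕K-3∕K-3c, `HistoryTailL ⟸ {K1-exp,
hImproveCoreFlat∣₂₁, MeanDeviationL}` (LEAD ∕ ★★OWNER WORD 13 decide the display).

WHAT (ns `…Theorems.PoincareLipschitzFlatOrganOfFlatCapped`).
* §1 ★★`sum_corr_varied_le_add_of_almostMin`, `energy_box_eq_sum_dot_flat`.
* §2 ★★`exists_scale_energy_le_flatOrgan (hc : 20 ≤ c)`.
* §3 ★★★`hImproveCoreFlat_of_flatCapped (hF : ⟨Flat v1 with «∀ (Λ₀ …), 0 < Λ₀ →» deleted, «Λ₀ * R» ↦ «21 * R»⟩) : ⟨hImproveCoreFlat v1 bac8eda3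
  VERBATIM (= ✓K-5's `hF` binder)⟩` (decl-local `maxHeartbeats 400000`, RULING №24 (d): `Nat.floor`∕`Nat.ceil` real arithmetic).
HONEST SCOPE.  A reduction between two displayed texts; `hImproveCoreFlat∣₂₁` ∕ `hImproveCoreFlat` (SU84 ∕ Luckhaus-class lattice regularity — NOT
in print), `hImproveCore`, `hImprove`, K1-exp, `MeanDeviationL`, `BlockLipschitzL`, `HistoryTailL` NOT proved.  YM₃ on T³ is rung R3, NOT Clay.

References: R. Schoen, K. Uhlenbeck, Invent. Math. **78** (1984) 89–100 [SchoenUhlenbeck1984] §2; R. Schoen, K. Uhlenbeck, J. Diff. Geom. **17**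
(1982) 307–335 [SchoenUhlenbeck1982] §2 (almost ∕ local minimality); S. Luckhaus, Indiana Univ. Math. J. **37** (1988) 349–367.
-/

set_option autoImplicit false

noncomputable section

open scoped BigOperators InnerProductSpace
open Finset Matrix WithLp

namespace Summit.QuantumFields.YangMills.Theorems.PoincareLipschitzFlatOrganOfFlatCapped

open Literature.MathematicalPhysics.QuantumFieldTheory.Balaban1983to89.B4Eq19LatticeOperators
  (Zd unitVec box mem_box box_mono card_box add_unitVec_mem_box sub_unitVec_mem_box self_mem_box)
open Summit.QuantumFields.YangMills.Theorems.PoincareLipschitzLogCutoffStabilityCapFlat (exists_scale_energy_le_flat)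
open Summit.QuantumFields.YangMills.Theorems.PoincareLipschitzEuclideanTwistDictionary
  (inner_eq_dot norm_sq_eq_dot dot_self_eq_one_of_norm norm_eq_one_of_ofLp_eq_varied eq_of_ofLp_eq_varied_of_zero)

/-! ## §1 The almost-minimality row feeds the slack Leung–Xin inequality; the flat box energy in coordinates -/

/-- For unit `w, w′ ∈ E⁴`: `‖w′ − w‖² = 2 − 2·(ofLp w ⬝ ofLp w′)`. [folklore] -/
theorem norm_sub_sq_eq_two_sub_dot {w w' : EuclideanSpace ℝ (Fin 4)} (hw : ‖w‖ = 1) (hw' : ‖w'‖ = 1) :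
    ‖w' - w‖ ^ 2 = 2 - 2 * dotProduct (ofLp w) (ofLp w') := by
  rw [@norm_sub_sq_real, hw, hw', real_inner_comm, inner_eq_dot]
  ring

/-- ★★ **THE FLAT ORGAN's (∀ (z' : Zd 3) (ρ : ℤ), 0 ≤ ρ → box z' (ρ + 1) ⊆ box z R →
        ∀ v : Zd 3 → EuclideanSpace ℝ (Fin 4), (∀ y, y ∉ box z' ρ → v y = u y) → (∀ y ∈ box z' ρ, ‖v y‖ = 1) →
        ∑ y ∈ box z' (ρ + 1), ∑ μ : Fin 3, ‖u (y + unitVec μ) - u y‖ ^ 2 ≤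
        (∑ y ∈ box z' (ρ + 1), ∑ μ : Fin 3, ‖v (y + unitVec μ) - v y‖ ^ 2) + δ * ((ρ : ℝ) + 1))-MINIMALITY ROW FEEDS THE SLACK LEUNG–XIN INEQUALITY.**  If `u` (unit, `E⁴`-valued) satisfies the FROZEN flat
organ's row «`E(u; Q_{ρ+1}(z′)) ≤ E(v; Q_{ρ+1}(z′)) + δ(ρ+1)` for unit competitors `v` agreeing with `u` off `Q_ρ(z′)`» on the sub-boxes of `Q_R(z)`,
then for every cutoff `η` supported in `Q_{2M}(z) ⊆ Q_{R−1}(z)`, field `a`, dilation `t`: the Leung–Xin varied correlation over `Q_R(z) × Fin 3`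
exceeds the correlation of `u` by at most `δR∕2`. [cite: SchoenUhlenbeck1982, §2; Xin1980, p.609–613] -/
theorem sum_corr_varied_le_add_of_almostMin (u : Zd 3 → EuclideanSpace ℝ (Fin 4)) (hu : ∀ y, ‖u y‖ = 1)
    (z : Zd 3) (R : ℤ) (hR : 1 ≤ R) (M : ℕ) (h2MR : 2 * (M : ℤ) ≤ R - 1) {δ : ℝ}
    (halmost : (∀ (z' : Zd 3) (ρ : ℤ), 0 ≤ ρ → box z' (ρ + 1) ⊆ box z R →
        ∀ v : Zd 3 → EuclideanSpace ℝ (Fin 4), (∀ y, y ∉ box z' ρ → v y = u y) → (∀ y ∈ box z' ρ, ‖v y‖ = 1) →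
        ∑ y ∈ box z' (ρ + 1), ∑ μ : Fin 3, ‖u (y + unitVec μ) - u y‖ ^ 2 ≤
        (∑ y ∈ box z' (ρ + 1), ∑ μ : Fin 3, ‖v (y + unitVec μ) - v y‖ ^ 2) + δ * ((ρ : ℝ) + 1)))
    (η : Zd 3 → ℝ) (hηout : ∀ y ∉ box z (2 * (M : ℤ)), η y = 0) (a : Fin 4) (t : ℝ) :
    ∑ y ∈ box z R, ∑ μ : Fin 3, dotProduct ((Real.sqrt (1 + t ^ 2 * dotProduct (η y • (Pi.single a 1 - dotProduct (Pi.single a 1) (ofLp (u y)) • ofLp (u y)))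
        (η y • (Pi.single a 1 - dotProduct (Pi.single a 1) (ofLp (u y)) • ofLp (u y)))))⁻¹ •
      (ofLp (u y) + t • (η y • (Pi.single a 1 - dotProduct (Pi.single a 1) (ofLp (u y)) • ofLp (u y))))) ((Real.sqrt (1 + t ^ 2 * dotProduct (η (y + unitVec μ) • (Pi.single a 1 - dotProduct (Pi.single a 1) (ofLp (u (y + unitVec μ))) • ofLp (u (y + unitVec μ))))
        (η (y + unitVec μ) • (Pi.single a 1 - dotProduct (Pi.single a 1) (ofLp (u (y + unitVec μ))) • ofLp (u (y + unitVec μ))))))⁻¹ •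
      (ofLp (u (y + unitVec μ)) + t • (η (y + unitVec μ) • (Pi.single a 1 - dotProduct (Pi.single a 1) (ofLp (u (y + unitVec μ))) • ofLp (u (y + unitVec μ)))))) ≤
      (∑ y ∈ box z R, ∑ μ : Fin 3, dotProduct (ofLp (u y)) (ofLp (u (y + unitVec μ)))) + δ * (R : ℝ) / 2 := by
  classical
  set v : Zd 3 → EuclideanSpace ℝ (Fin 4) := fun x => toLp 2 ((Real.sqrt (1 + t ^ 2 * dotProduct (η x • (Pi.single a 1 - dotProduct (Pi.single a 1) (ofLp (u x)) • ofLp (u x)))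
        (η x • (Pi.single a 1 - dotProduct (Pi.single a 1) (ofLp (u x)) • ofLp (u x)))))⁻¹ •
      (ofLp (u x) + t • (η x • (Pi.single a 1 - dotProduct (Pi.single a 1) (ofLp (u x)) • ofLp (u x))))) with hv
  have hvx : ∀ x, ofLp (v x) = (Real.sqrt (1 + t ^ 2 * dotProduct (η x • (Pi.single a 1 - dotProduct (Pi.single a 1) (ofLp (u x)) • ofLp (u x)))
        (η x • (Pi.single a 1 - dotProduct (Pi.single a 1) (ofLp (u x)) • ofLp (u x)))))⁻¹ •
      (ofLp (u x) + t • (η x • (Pi.single a 1 - dotProduct (Pi.single a 1) (ofLp (u x)) • ofLp (u x)))) := fun x => by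
    simp only [hv, WithLp.ofLp_toLp]
  have hv1 : ∀ x, ‖v x‖ = 1 := fun x => norm_eq_one_of_ofLp_eq_varied u hu η a t x (v x) (hvx x)
  have hvout : ∀ y, y ∉ box z (R - 1) → v y = u y := by
    intro y hy
    have hy' : y ∉ box z (2 * (M : ℤ)) := fun h => hy (box_mono z h2MR h)
    exact eq_of_ofLp_eq_varied_of_zero u a t (hηout y hy') (v y) (hvx y)
  have hrow := halmost z (R - 1) (by linarith) (by rw [sub_add_cancel]) v hvout (fun y _ => hv1 y)
  rw [sub_add_cancel] at hrow
  have hU : ∀ (y : Zd 3) (μ : Fin 3), ‖u (y + unitVec μ) - u y‖ ^ 2 = 2 - 2 * dotProduct (ofLp (u y)) (ofLp (u (y + unitVec μ))) :=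
    fun y μ => norm_sub_sq_eq_two_sub_dot (hu y) (hu _)
  have hV : ∀ (y : Zd 3) (μ : Fin 3), ‖v (y + unitVec μ) - v y‖ ^ 2 = 2 - 2 * dotProduct (ofLp (v y)) (ofLp (v (y + unitVec μ))) :=
    fun y μ => norm_sub_sq_eq_two_sub_dot (hv1 y) (hv1 _)
  simp only [hU, hV] at hrow
  have hsplit : ∀ g : Zd 3 → Fin 3 → ℝ, ∑ y ∈ box z R, ∑ μ : Fin 3, (2 - 2 * g y μ) =
      ∑ y ∈ box z R, ∑ _μ : Fin 3, (2 : ℝ) - 2 * ∑ y ∈ box z R, ∑ μ : Fin 3, g y μ := by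
    intro g
    rw [Finset.mul_sum, ← Finset.sum_sub_distrib]
    refine Finset.sum_congr rfl fun y _ => ?_
    rw [Finset.mul_sum, ← Finset.sum_sub_distrib]
  rw [hsplit (fun y μ => dotProduct (ofLp (u y)) (ofLp (u (y + unitVec μ)))),
    hsplit (fun y μ => dotProduct (ofLp (v y)) (ofLp (v (y + unitVec μ))))] at hrow
  have hcast : δ * (((R - 1 : ℤ) : ℝ) + 1) = δ * (R : ℝ) := by push_cast; ring
  rw [hcast] at hrow
  simp only [hvx] at hrow
  linarith

/-- The flat box energy in coordinates. [folklore] -/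
theorem energy_box_eq_sum_dot_flat (u : Zd 3 → EuclideanSpace ℝ (Fin 4)) (z : Zd 3) (ρ : ℤ) :
    ∑ y ∈ box z ρ, ∑ μ : Fin 3, ‖u (y + unitVec μ) - u y‖ ^ 2 =
      ∑ b ∈ (box z ρ) ×ˢ (Finset.univ : Finset (Fin 3)),
        dotProduct (ofLp (u b.1) - ofLp (u (b.1 + unitVec b.2))) (ofLp (u b.1) - ofLp (u (b.1 + unitVec b.2))) := by
  rw [Finset.sum_product]
  refine Finset.sum_congr rfl fun y _ => Finset.sum_congr rfl fun μ _ => ?_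
  rw [norm_sub_rev, norm_sq_eq_dot, WithLp.ofLp_sub]

/-! ## §2 One good scale per window, in the flat organ's letters -/

/-- ★★ **ONE GOOD SCALE PER WINDOW FOR THE FLAT ORGAN.**  For every `c ≥ 20` there is `C₁ ≥ 1`: if `u : ℤ³ → S³ ⊂ E⁴` satisfies the flat organ's
almost-minimality row with slack `δ(ρ+1)` on the sub-boxes of `Q_R(z)`, and `1 ≤ r`, `C₁r ≤ M`, `2M ≤ R − 1`, `1600·δR ≤ r`, then some `k ∈ [r, M)`
has `E(Q_{k−1}(z)) ≤ c·k`. (✓`exists_scale_energy_le_flat` on `Q_R(z) × Fin 3` through §1.) [cite: SchoenUhlenbeck1984, §2; Xin1980, p.609–613] -/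
theorem exists_scale_energy_le_flatOrgan {c : ℝ} (hc : 20 ≤ c) : ∃ C₁ : ℝ, 1 ≤ C₁ ∧
    ∀ (u : Zd 3 → EuclideanSpace ℝ (Fin 4)) (z : Zd 3) (R : ℤ) (δ : ℝ) (r M : ℕ),
      (∀ y, ‖u y‖ = 1) →
      (∀ (z' : Zd 3) (ρ : ℤ), 0 ≤ ρ → box z' (ρ + 1) ⊆ box z R →
        ∀ v : Zd 3 → EuclideanSpace ℝ (Fin 4), (∀ y, y ∉ box z' ρ → v y = u y) → (∀ y ∈ box z' ρ, ‖v y‖ = 1) →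
        ∑ y ∈ box z' (ρ + 1), ∑ μ : Fin 3, ‖u (y + unitVec μ) - u y‖ ^ 2 ≤
        (∑ y ∈ box z' (ρ + 1), ∑ μ : Fin 3, ‖v (y + unitVec μ) - v y‖ ^ 2) + δ * ((ρ : ℝ) + 1)) →
      1 ≤ R → 1 ≤ r → C₁ * r ≤ M → 2 * (M : ℤ) ≤ R - 1 → 1600 * δ * (R : ℝ) ≤ r →
      ∃ k : ℕ, r ≤ k ∧ k < M ∧
        ∑ y ∈ box z ((k : ℤ) - 1), ∑ μ : Fin 3, ‖u (y + unitVec μ) - u y‖ ^ 2 ≤ c * k := by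
  classical
  obtain ⟨C₁, hC₁, hmainC⟩ := exists_scale_energy_le_flat hc
  refine ⟨C₁, hC₁, ?_⟩
  intro u z R δ r M hu halmost hR1 hr1 hM_ge h2MR hsmall
  have hMR : (M : ℤ) ≤ R := by linarith
  set T : Finset (Zd 3 × Fin 3) := (box z R) ×ˢ (Finset.univ : Finset (Fin 3)) with hT
  have hu' : ∀ x, dotProduct (ofLp (u x)) (ofLp (u x)) = 1 := fun x => dot_self_eq_one_of_norm (hu x)
  have hσ : 3200 * (δ * (R : ℝ) / 2) ≤ r := by linarith
  have hminC : ∀ η : Zd 3 → ℝ, (∀ y ∉ box z (2 * (M : ℤ)), η y = 0) → (∀ y, 0 ≤ η y) → (∀ y, η y ≤ 1) → ∀ (a : Fin 4) (t : ℝ),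
      ∑ b ∈ T, dotProduct
        ((Real.sqrt (1 + t ^ 2 * dotProduct (η b.1 • (Pi.single a 1 - dotProduct (Pi.single a 1) (ofLp (u b.1)) • ofLp (u b.1)))
            (η b.1 • (Pi.single a 1 - dotProduct (Pi.single a 1) (ofLp (u b.1)) • ofLp (u b.1)))))⁻¹ •
          (ofLp (u b.1) + t • (η b.1 • (Pi.single a 1 - dotProduct (Pi.single a 1) (ofLp (u b.1)) • ofLp (u b.1)))))
        ((Real.sqrt (1 + t ^ 2 * dotProduct (η (b.1 + unitVec b.2) •
              (Pi.single a 1 - dotProduct (Pi.single a 1) (ofLp (u (b.1 + unitVec b.2))) • ofLp (u (b.1 + unitVec b.2))))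
            (η (b.1 + unitVec b.2) • (Pi.single a 1 - dotProduct (Pi.single a 1) (ofLp (u (b.1 + unitVec b.2))) • ofLp (u (b.1 + unitVec b.2))))))⁻¹ •
          (ofLp (u (b.1 + unitVec b.2)) + t • (η (b.1 + unitVec b.2) •
            (Pi.single a 1 - dotProduct (Pi.single a 1) (ofLp (u (b.1 + unitVec b.2))) • ofLp (u (b.1 + unitVec b.2)))))) ≤
      (∑ b ∈ T, dotProduct (ofLp (u b.1)) (ofLp (u (b.1 + unitVec b.2)))) + δ * (R : ℝ) / 2 := by
    intro η hηout _hη0 _hη1 a t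
    rw [hT, Finset.sum_product, Finset.sum_product]
    exact sum_corr_varied_le_add_of_almostMin u hu z R hR1 M h2MR halmost η hηout a t
  obtain ⟨k, hrk, hkM, hEk⟩ := hmainC T (fun y => ofLp (u y)) z r M (δ * (R : ℝ) / 2) hu' hr1 hM_ge hσ hminC
  refine ⟨k, hrk, hkM, ?_⟩
  have hkR : (k : ℤ) ≤ R := le_trans (by exact_mod_cast hkM.le) hMR
  have h2 : (box z ((k : ℤ) - 1)) ×ˢ (Finset.univ : Finset (Fin 3)) ⊆
      T.filter (fun b => b.1 ∈ box z (k : ℤ) ∧ b.1 + unitVec b.2 ∈ box z (k : ℤ)) := by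
    intro b hb
    rw [Finset.mem_product] at hb
    rw [Finset.mem_filter, hT, Finset.mem_product]
    have hb1 : b.1 ∈ box z (k : ℤ) := box_mono z (by linarith) hb.1
    refine ⟨⟨box_mono z hkR hb1, Finset.mem_univ _⟩, hb1, ?_⟩
    have := add_unitVec_mem_box hb.1 b.2
    rwa [sub_add_cancel] at this
  have he0 : ∀ b ∈ T.filter (fun b => b.1 ∈ box z (k : ℤ) ∧ b.1 + unitVec b.2 ∈ box z (k : ℤ)),
      b ∉ (box z ((k : ℤ) - 1)) ×ˢ (Finset.univ : Finset (Fin 3)) →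
      0 ≤ dotProduct (ofLp (u b.1) - ofLp (u (b.1 + unitVec b.2))) (ofLp (u b.1) - ofLp (u (b.1 + unitVec b.2))) :=
    fun b _ _ => by
      simp only [dotProduct, Pi.sub_apply]
      exact Finset.sum_nonneg fun i _ => mul_self_nonneg _
  rw [energy_box_eq_sum_dot_flat]
  exact le_trans (Finset.sum_le_sum_of_subset_of_nonneg h2 he0) hEk

/-! ## §3 ★★★ The organ of record is parameter-free: `hImproveCoreFlat∣_{Λ₀ := 21} ⟹ hImproveCoreFlat` -/

set_option maxHeartbeats 400000 in
/-- ★★★ **`hImproveCoreFlat∣_{Λ₀ := 21} ⟹ hImproveCoreFlat` v1 (bac8eda3, VERBATIM).**  The flat organ at the SINGLE energy level `21` — hypothesis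
`hF` = the frozen text with `∀ (Λ₀ …), 0 < Λ₀ →` deleted and `Λ₀ * R ↦ 21 * R` — implies the frozen organ at every level: `δ := min δ′ (6400C₁)⁻¹`
makes the almost-minimality slack harmless for the cap at `c = 20` (§2), which returns `k ∈ [r, M)` with `E(Q_{k−1}) ≤ 20k ≤ 21(k−1)`; the capped
organ at the top scale `k − 1` gives the good scale.  So the K2 organ of record (RULING g9-8) is equivalently the PARAMETER-FREE statement «flat
`δ(ρ+1)`-almost-minimising unit lattice maps `ℤ³ → S³ ⊂ ℝ⁴` with `E(Q_R) ≤ 21R` have `E(Q_{2r}) ≤ ε₁r` at ONE comparable scale».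
[cite: SchoenUhlenbeck1984, §2; SchoenUhlenbeck1982, §2] -/
theorem hImproveCoreFlat_of_flatCapped
    (hF : ∀ (ε₁ : ℝ), 0 < ε₁ →
      ∃ (δ C₀ R₀ : ℝ), 0 < δ ∧ 1 ≤ C₀ ∧ 1 ≤ R₀ ∧
      ∀ (u : Zd 3 → EuclideanSpace ℝ (Fin 4)) (z : Zd 3) (R : ℤ),
      R₀ ≤ R →
      (∀ y, ‖u y‖ = 1) →
      (∀ (z' : Zd 3) (ρ : ℤ), 0 ≤ ρ → box z' (ρ + 1) ⊆ box z R →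
      ∀ v : Zd 3 → EuclideanSpace ℝ (Fin 4), (∀ y, y ∉ box z' ρ → v y = u y) → (∀ y ∈ box z' ρ, ‖v y‖ = 1) →
      ∑ y ∈ box z' (ρ + 1), ∑ μ : Fin 3, ‖u (y + unitVec μ) - u y‖ ^ 2 ≤
      (∑ y ∈ box z' (ρ + 1), ∑ μ : Fin 3, ‖v (y + unitVec μ) - v y‖ ^ 2) + δ * ((ρ : ℝ) + 1)) →
      (∑ y ∈ box z R, ∑ μ : Fin 3, ‖u (y + unitVec μ) - u y‖ ^ 2 ≤ 21 * R) →
      ∃ r : ℤ, 1 ≤ r ∧ (R : ℝ) ≤ C₀ * r ∧ 4 * r ≤ R ∧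
      ∑ y ∈ box z (2 * r), ∑ μ : Fin 3, ‖u (y + unitVec μ) - u y‖ ^ 2 ≤ ε₁ * r) :
    ∀ (Λ₀ ε₁ : ℝ), 0 < Λ₀ → 0 < ε₁ →
      ∃ (δ C₀ R₀ : ℝ), 0 < δ ∧ 1 ≤ C₀ ∧ 1 ≤ R₀ ∧
      ∀ (u : Zd 3 → EuclideanSpace ℝ (Fin 4)) (z : Zd 3) (R : ℤ),
      R₀ ≤ R →
      (∀ y, ‖u y‖ = 1) →
      (∀ (z' : Zd 3) (ρ : ℤ), 0 ≤ ρ → box z' (ρ + 1) ⊆ box z R →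
      ∀ v : Zd 3 → EuclideanSpace ℝ (Fin 4), (∀ y, y ∉ box z' ρ → v y = u y) → (∀ y ∈ box z' ρ, ‖v y‖ = 1) →
      ∑ y ∈ box z' (ρ + 1), ∑ μ : Fin 3, ‖u (y + unitVec μ) - u y‖ ^ 2 ≤
      (∑ y ∈ box z' (ρ + 1), ∑ μ : Fin 3, ‖v (y + unitVec μ) - v y‖ ^ 2) + δ * ((ρ : ℝ) + 1)) →
      (∑ y ∈ box z R, ∑ μ : Fin 3, ‖u (y + unitVec μ) - u y‖ ^ 2 ≤ Λ₀ * R) →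
      ∃ r : ℤ, 1 ≤ r ∧ (R : ℝ) ≤ C₀ * r ∧ 4 * r ≤ R ∧
      ∑ y ∈ box z (2 * r), ∑ μ : Fin 3, ‖u (y + unitVec μ) - u y‖ ^ 2 ≤ ε₁ * r := by
  classical
  intro Λ₀ ε₁ _hΛ₀ hε₁
  obtain ⟨C₁, hC₁, hscale⟩ := exists_scale_energy_le_flatOrgan (le_refl (20 : ℝ))
  obtain ⟨δ', C₀', R₀', hδ', hC₀', hR₀', hcap⟩ := hF ε₁ hε₁
  have hC₁0 : 0 < C₁ := by linarith
  set k₀ : ℝ := R₀' + 23 with hk₀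
  have hmax0 : 0 ≤ max (1296 * C₁) ((8 * C₁ + 10) * C₀') := le_trans (by positivity) (le_max_left _ _)
  have hCk : 0 ≤ C₁ * k₀ := mul_nonneg hC₁0.le (by linarith)
  refine ⟨min δ' (6400 * C₁)⁻¹, (8 * C₁ + 10) * C₀' + C₀', 2 * C₁ * (k₀ + 2) + 10 + 4 * C₁ + 5, lt_min hδ' (by positivity), ?_, ?_, ?_⟩
  · nlinarith
  · have : 2 * C₁ * (k₀ + 2) = 2 * (C₁ * k₀) + 4 * C₁ := by ring
    rw [this]; linarith
  intro u z R hR hu halmost _henergy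
  set δ : ℝ := min δ' (6400 * C₁)⁻¹ with hδ
  set C₀ : ℝ := (8 * C₁ + 10) * C₀' + C₀' with hC₀
  have hδδ' : δ ≤ δ' := min_le_left _ _
  have hδC : δ ≤ (6400 * C₁)⁻¹ := min_le_right _ _
  have hδ0 : 0 < δ := lt_min hδ' (by positivity)
  have hR' : 2 * (C₁ * k₀) + 4 * C₁ + 10 + 4 * C₁ + 5 ≤ (R : ℝ) := by
    have : 2 * C₁ * (k₀ + 2) = 2 * (C₁ * k₀) + 4 * C₁ := by ring
    rw [this] at hR; exact hR
  have hR10 : 10 + 4 * C₁ ≤ (R : ℝ) := by linarith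
  have hR1 : (1 : ℝ) ≤ R := by linarith
  have hR1' : 1 ≤ R := by exact_mod_cast hR1
  -- the scales `r` and `M`
  set r : ℕ := ⌊((R : ℝ) - 5) / (2 * C₁)⌋₊ with hr_def
  set M : ℕ := ⌈C₁ * r⌉₊ with hM_def
  have hx0 : 0 ≤ ((R : ℝ) - 5) / (2 * C₁) := div_nonneg (by linarith) (by positivity)
  have hr_le : (r : ℝ) * (2 * C₁) ≤ (R : ℝ) - 5 := (le_div_iff₀ (by positivity)).1 (Nat.floor_le hx0)
  have hr_gt : (R : ℝ) - 5 < ((r : ℝ) + 1) * (2 * C₁) := (div_lt_iff₀ (by positivity)).1 (Nat.lt_floor_add_one _)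
  have hrk₀ : k₀ + 1 ≤ r := by
    by_contra h
    push Not at h
    have : ((r : ℝ) + 1) * (2 * C₁) < (k₀ + 2) * (2 * C₁) := mul_lt_mul_of_pos_right (by linarith) (by positivity)
    have h' : (k₀ + 2) * (2 * C₁) = 2 * (C₁ * k₀) + 4 * C₁ := by ring
    linarith
  have hr1 : 1 ≤ r := by
    have : (1 : ℝ) ≤ r := by linarith
    exact_mod_cast this
  have hr0 : (0 : ℝ) < r := by exact_mod_cast hr1
  have hM_ge : C₁ * r ≤ M := Nat.le_ceil _
  have hM_lt : (M : ℝ) < C₁ * r + 1 := Nat.ceil_lt_add_one (by positivity)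
  have h2MR : 2 * (M : ℤ) ≤ R - 1 := by
    have h1 : 2 * (M : ℝ) < R - 3 := by linarith
    have h3 : 2 * (M : ℤ) < R - 3 := by exact_mod_cast h1
    linarith
  have hrR4 : (R : ℝ) ≤ r * (4 * C₁) := by nlinarith
  -- the slack is harmless: `1600 δ R ≤ r`
  have hsmall : 1600 * δ * (R : ℝ) ≤ r := by
    have h1 : 1600 * δ * (R : ℝ) ≤ 1600 * δ * (r * (4 * C₁)) := mul_le_mul_of_nonneg_left hrR4 (by positivity)
    have h2 : δ * (6400 * C₁) ≤ 1 := by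
      have := mul_le_mul_of_nonneg_right hδC (by positivity : (0:ℝ) ≤ 6400 * C₁)
      rwa [inv_mul_cancel₀ (by positivity : (6400 : ℝ) * C₁ ≠ 0)] at this
    have h3 : 1600 * δ * (r * (4 * C₁)) = r * (δ * (6400 * C₁)) := by ring
    rw [h3] at h1
    have h4 : (r : ℝ) * (δ * (6400 * C₁)) ≤ r * 1 := mul_le_mul_of_nonneg_left h2 hr0.le
    linarith
  -- ★ one good scale (§2) at `c = 20`
  obtain ⟨k, hrk, hkM, hEk⟩ := hscale u z R δ r M hu halmost hR1' hr1 hM_ge h2MR hsmall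
  have hMR : (M : ℤ) ≤ R := by linarith
  have hrk' : (r : ℝ) ≤ k := by exact_mod_cast hrk
  have hk3 : (24 : ℝ) ≤ k := by rw [hk₀] at hrk₀; linarith
  have hkR₀ : R₀' ≤ ((k : ℤ) - 1 : ℤ) := by
    have h3 : (((k : ℤ) - 1 : ℤ) : ℝ) = (k : ℝ) - 1 := by push_cast; ring
    rw [h3, hk₀] at *; linarith
  have hkR : (k : ℤ) ≤ R := le_trans (by exact_mod_cast hkM.le) hMR
  have hEtop : ∑ y ∈ box z ((k : ℤ) - 1), ∑ μ : Fin 3, ‖u (y + unitVec μ) - u y‖ ^ 2 ≤ 21 * ((((k : ℤ) - 1 : ℤ) : ℝ)) := by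
    have h3 : (((k : ℤ) - 1 : ℤ) : ℝ) = (k : ℝ) - 1 := by push_cast; ring
    rw [h3]
    refine hEk.trans ?_
    linarith
  -- ★ the capped organ at the top scale `k − 1` (slack `δ ≤ δ′`, rows hereditary)
  obtain ⟨r', hr'1, hr'C, hr'4, hr'E⟩ := hcap u z ((k : ℤ) - 1) hkR₀ hu
    (fun z' ρ hρ hsub v hv hv1 => by
      have h := halmost z' ρ hρ (hsub.trans (box_mono z (by linarith))) v hv hv1
      have hρr : (0 : ℝ) ≤ ρ := by exact_mod_cast hρ
      have hρ0 : 0 ≤ (ρ : ℝ) + 1 := by linarith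
      have := mul_le_mul_of_nonneg_right hδδ' hρ0
      linarith)
    hEtop
  refine ⟨r', hr'1, ?_, le_trans hr'4 (by linarith), hr'E⟩
  -- `R ≤ C₀ r′`
  have h1 : (((k : ℤ) - 1 : ℤ) : ℝ) = (k : ℝ) - 1 := by push_cast; ring
  rw [h1] at hr'C
  have hr'1' : (1 : ℝ) ≤ r' := by exact_mod_cast hr'1
  have h3 : (R : ℝ) ≤ (6 * C₁ + 5) * ((k : ℝ) - 1) := by
    have : ((k : ℝ) + 1) * (2 * C₁) ≤ 3 * ((k : ℝ) - 1) * (2 * C₁) := mul_le_mul_of_nonneg_right (by linarith) (by positivity)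
    have h2 : ((r : ℝ) + 1) * (2 * C₁) ≤ ((k : ℝ) + 1) * (2 * C₁) := mul_le_mul_of_nonneg_right (by linarith) (by positivity)
    nlinarith
  have h4 : (6 * C₁ + 5) * ((k : ℝ) - 1) ≤ (6 * C₁ + 5) * (C₀' * r') := mul_le_mul_of_nonneg_left hr'C (by positivity)
  have h5 : (6 * C₁ + 5) * (C₀' * r') ≤ (8 * C₁ + 10) * C₀' * r' := by
    have : 0 ≤ C₀' * r' := by positivity
    nlinarith
  have hC₀ge2 : (8 * C₁ + 10) * C₀' ≤ C₀ := by rw [hC₀]; linarith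
  calc (R : ℝ) ≤ (8 * C₁ + 10) * C₀' * r' := by linarith
    _ ≤ C₀ * r' := mul_le_mul_of_nonneg_right hC₀ge2 (by linarith)

end Summit.QuantumFields.YangMills.Theorems.PoincareLipschitzFlatOrganOfFlatCapped

end
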